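import Summits.CriticalPhenomena.PercolationContinuityZ3.Theorems.Transplant.FKConnectivityAllQAntipodalX2WordsHull
import HarnessLib

/-!
# Connectivity correlation inequalities for `φ_{w,q}` — the TYPE-WORD MODEL of `X2`, file 4: hulls of shifted words and the
# one-sidedness of soliton words (memo g13 Lemma 3.5(a))

Helper file (`--supports stmt-CriticalPhenomena-4575`), FK sub-lane `prim-bschramm-fk-2` (gen 13); builds on p205010 (kernel
theorem, internal audit signed; external expert review pending).  Pure finite combinatorics on the type-word model of
`…AntipodalX2Words` (memo `bschramm/FROM-fk-2-g13-WORD-HALL.md`).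
* `hullStart_cons_of_ne`, `hullStart_replicate_append`, `hullEnd_concat_of_ne`, `hullEnd_append_replicate`, …: hull calculus;
* `rowA_eq_nil_iff` / `rowB_eq_nil_iff`: a row is empty iff no block is visible to it;
* `isSoliton_false_of_rows_ne_nil`: the hull part of a soliton word is invisible to one of the rows, so a word whose hull part has two
  nonempty rows ("generic") fails the soliton test of RULE N.
[cite: Grimmett2006, §3.9 (p. 63)]
-/

namespace Summit.CriticalPhenomena.PercolationContinuityZ3.Theorems

namespace FK

namespace X2Word

/-! ### Hull of shifted / extended words -/

section HullCalc

/-- `hullStart` of a `cons` with a non-ground head. [folklore] -/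
theorem hullStart_cons_of_ne {e : Ty} (he : e ≠ .E) (l : List Ty) : hullStart (e :: l) = some 0 := by
  rw [hullStart_eq_some_iff]
  exact ⟨by simp, by simpa using he, fun j hj => absurd hj (Nat.not_lt_zero j)⟩

/-- `hullStart` of a `cons` with a ground head. [folklore] -/
theorem hullStart_cons_E (l : List Ty) : hullStart (.E :: l) = (hullStart l).map (· + 1) := by
  unfold hullStart
  rw [List.findIdx?_cons]
  simp

/-- `hullStart` after a ground prefix. [folklore] -/
theorem hullStart_replicate_append (a : ℕ) (l : List Ty) :
    hullStart (List.replicate a .E ++ l) = (hullStart l).map (· + a) := by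
  induction a with
  | zero => simp
  | succ a ih =>
    rw [List.replicate_succ, List.cons_append, hullStart_cons_E, ih, Option.map_map]
    rfl

/-- `hullStart` is determined by a prefix containing a non-ground block. [folklore] -/
theorem hullStart_append_of_some {l : List Ty} {i : ℕ} (hl : hullStart l = some i) (l' : List Ty) :
    hullStart (l ++ l') = some i := by
  rw [hullStart_eq_some_iff] at hl ⊢
  obtain ⟨hi, h1, h2⟩ := hl
  refine ⟨by simp; omega, ?_, ?_⟩
  · rw [List.getElem_append_left hi]; exact h1
  · intro j hj; rw [List.getElem_append_left (by omega)]; exact h2 j hj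

/-- `hullEnd` of a `snoc` with a non-ground last block. [folklore] -/
theorem hullEnd_concat_of_ne (l : List Ty) {e : Ty} (he : e ≠ .E) : hullEnd (l ++ [e]) = some l.length := by
  rw [hullEnd_eq_some_iff]
  refine ⟨by simp, by simp [he], fun j hj hlt => ?_⟩
  simp at hj; omega

/-- `hullEnd` is unchanged by a ground suffix. [folklore] -/
theorem hullEnd_append_replicate (l : List Ty) (b : ℕ) : hullEnd (l ++ List.replicate b .E) = hullEnd l := by
  cases hl : hullEnd l with
  | none =>
    rw [hullEnd_eq_none_iff] at hl ⊢
    intro e he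
    rcases List.mem_append.mp he with h | h
    · exact hl e h
    · exact (List.eq_of_mem_replicate h)
  | some i =>
    rw [hullEnd_eq_some_iff] at hl ⊢
    obtain ⟨hi, h1, h2⟩ := hl
    refine ⟨by simp; omega, ?_, ?_⟩
    · rw [List.getElem_append_left hi]; exact h1
    · intro j hj hlt
      by_cases hjl : j < l.length
      · rw [List.getElem_append_left hjl]; exact h2 j hjl hlt
      · rw [List.getElem_append_right (by omega)]; simp

/-- `hullEnd` is determined by a suffix containing a non-ground block. [folklore] -/
theorem hullEnd_append_of_some (l' : List Ty) {l : List Ty} {i : ℕ} (hl : hullEnd l = some i) :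
    hullEnd (l' ++ l) = some (l'.length + i) := by
  rw [hullEnd_eq_some_iff] at hl ⊢
  obtain ⟨hi, h1, h2⟩ := hl
  refine ⟨by simp; omega, ?_, ?_⟩
  · rw [List.getElem_append_right (by omega)]; simpa using h1
  · intro j hj hlt
    rw [List.getElem_append_right (by omega)]
    exact h2 _ _ (by omega)

end HullCalc

/-! ### Soliton words have a one-sided hull part (memo g13 3.5(a)) -/

section Trichotomy

/-- Kinds by parity. [folklore] -/
theorem kindAt_eq_of_mod (k : Kind) (i : ℕ) : kindAt k i = if i % 2 = 0 then k else k.other := by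
  induction i with
  | zero => simp
  | succ i ih =>
    rw [kindAt_succ, ih]
    by_cases hi : i % 2 = 0
    · simp [hi, show (i + 1) % 2 ≠ 0 by omega]
    · simp [hi, show (i + 1) % 2 = 0 by omega]

/-- Row `A` is empty iff no block is `A`-visible. [folklore] -/
theorem rowA_eq_nil_iff (k : Kind) (l : List Ty) :
    rowA k l = [] ↔ ∀ (i : ℕ) (hi : i < l.length), visA (kindAt k i) l[i] = false := by
  induction l generalizing k with
  | nil => simp
  | cons e l ih =>
    rw [rowA_cons, List.append_eq_nil_iff, ih]
    constructor
    · rintro ⟨h1, h2⟩ i hi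
      cases i with
      | zero => simpa using h1
      | succ i => simpa [kindAt_succ, kindAt] using h2 i (by simpa using hi)
    · intro hall
      refine ⟨?_, fun i hi => ?_⟩
      · have h0 := hall 0 (by simp)
        rw [List.getElem_cons_zero] at h0
        simpa using h0
      · have := hall (i + 1) (by simpa using hi)
        simpa [kindAt_succ, kindAt, Function.iterate_succ_apply] using this

/-- Row `B` is empty iff no block is `B`-visible. [folklore] -/
theorem rowB_eq_nil_iff (k : Kind) (l : List Ty) :
    rowB k l = [] ↔ ∀ (i : ℕ) (hi : i < l.length), visB (kindAt k i) l[i] = false := by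
  induction l generalizing k with
  | nil => simp
  | cons e l ih =>
    rw [rowB_cons, List.append_eq_nil_iff, ih]
    constructor
    · rintro ⟨h1, h2⟩ i hi
      cases i with
      | zero => simpa using h1
      | succ i => simpa [kindAt_succ, kindAt] using h2 i (by simpa using hi)
    · intro hall
      refine ⟨?_, fun i hi => ?_⟩
      · have h0 := hall 0 (by simp)
        rw [List.getElem_cons_zero] at h0
        simpa using h0
      · have := hall (i + 1) (by simpa using hi)
        simpa [kindAt_succ, kindAt, Function.iterate_succ_apply] using this

/-- Entries of the soliton pattern. [folklore] -/
theorem getElem_solitonPattern (n h m i : ℕ) (hi : i < (solitonPattern n h m).length) :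
    (solitonPattern n h m)[i] = if h ≤ i ∧ i ≤ h + 2 * m ∧ (i - h) % 2 = 0 then .F else .E := by
  simp [solitonPattern]

/-- Length of the soliton pattern. [folklore] -/
@[simp] theorem length_solitonPattern (n h m : ℕ) : (solitonPattern n h m).length = n := by
  simp [solitonPattern]

/-- **Trichotomy (memo g13 3.5(a)), the direction used by RULE N:** a soliton word's hull part is invisible to one of the two rows;
hence a word whose hull part has two nonempty rows fails the soliton test. [folklore] -/
theorem isSoliton_false_of_rows_ne_nil {k₀ : Kind} {x : List Ty} {h h' : ℕ}
    (hs : hullStart x = some h) (he : hullEnd x = some h')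
    (hA : rowA (kindAt k₀ h) ((x.drop h).take (h' + 1 - h)) ≠ [])
    (hB : rowB (kindAt k₀ h) ((x.drop h).take (h' + 1 - h)) ≠ []) :
    isSoliton k₀ x (kindAt k₀ h) h ((h' - h) / 2) = false := by
  by_contra hsol
  rw [Bool.not_eq_false] at hsol
  unfold isSoliton at hsol
  simp only [Bool.and_eq_true, decide_eq_true_eq] at hsol
  obtain ⟨⟨-, hlt⟩, hpat⟩ := hsol
  obtain ⟨hle, hh', -⟩ := hull_decomp hs he
  set m := (h' - h) / 2 with hm
  have hget : ∀ (i : ℕ) (hi : i < x.length), x[i] = if h ≤ i ∧ i ≤ h + 2 * m ∧ (i - h) % 2 = 0 then .F else .E := by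
    intro i hi
    rw [List.getElem_of_eq hpat hi, getElem_solitonPattern]
  have hpget : ∀ (i : ℕ) (hi : i < ((x.drop h).take (h' + 1 - h)).length),
      ((x.drop h).take (h' + 1 - h))[i] = if i ≤ 2 * m ∧ i % 2 = 0 then .F else .E := by
    intro i hi
    simp only [List.getElem_take, List.getElem_drop, hget]
    simp at hi
    have e1 : h ≤ h + i := by omega
    simp only [e1, true_and, Nat.add_sub_cancel_left]
    by_cases hi2 : i ≤ 2 * m <;> simp [hi2]
  have hh'le : h' ≤ h + 2 * m := by
    by_contra hc
    obtain ⟨_, hne, _⟩ := (hullEnd_eq_some_iff x h').mp he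
    apply hne
    rw [hget]
    simp only [ite_eq_right_iff]
    intro hh; omega
  cases hk : kindAt k₀ h with
  | W =>
    rw [hk] at hA
    apply hA
    rw [rowA_eq_nil_iff]
    intro i hi
    rw [hpget i hi, kindAt_eq_of_mod]
    by_cases hp : i % 2 = 0
    · by_cases hi2 : i ≤ 2 * m
      · simp [hp, hi2, visA]
      · exfalso; simp at hi; omega
    · simp [hp, visA]
  | P =>
    rw [hk] at hB
    apply hB
    rw [rowB_eq_nil_iff]
    intro i hi
    rw [hpget i hi, kindAt_eq_of_mod]
    by_cases hp : i % 2 = 0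
    · by_cases hi2 : i ≤ 2 * m
      · simp [hp, hi2, visB]
      · exfalso; simp at hi; omega
    · simp [hp, visB]

/-- `isSoliton_false_of_rows_ne_nil` with the hull part as a variable. [folklore] -/
theorem isSoliton_false_of_rows_ne_nil' {k₀ : Kind} {x : List Ty} {h h' : ℕ}
    (hs : hullStart x = some h) (he : hullEnd x = some h') {hp : List Ty} (hhp : hp = (x.drop h).take (h' + 1 - h))
    (hA : rowA (kindAt k₀ h) hp ≠ []) (hB : rowB (kindAt k₀ h) hp ≠ []) :
    isSoliton k₀ x (kindAt k₀ h) h ((h' - h) / 2) = false :=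
  isSoliton_false_of_rows_ne_nil hs he (hhp ▸ hA) (hhp ▸ hB)

end Trichotomy



end X2Word

end FK

end Summit.CriticalPhenomena.PercolationContinuityZ3.Theorems
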